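import Summits.HubbardSuperconductivity.HubbardSuperconductivity.Theorems.CwChiralConstruction.Negative.PressureSandwich
import Literature.MathematicalPhysics.QuantumLattice.DWaveSourceFreeGainBound

/-!
# Crux `CwChiralConstruction` (item `stmt-HubbardSuperconductivity-1740`, route `ChiralWindow`):
# the Cooper–Legendre ceiling on the Koma–Tasaki `d`-wave order parameter at weak coupling

Negative-side support lemmas from the standing disprover (cdisprove, cycle 1), part 2 of 2. The crux
asks for the FLOOR `exp(-C/U²) ≤ dWaveOrderParameter U μ` (all small `U > 0`, some doping
`δ_U ∈ [0.3,0.48]` and a density-matched `μ`). Here: the complementary CEILING and the strengthenings it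
excludes (sorry-free; no definition, no named fact).

* `liminf_dWaveSourceDensity_le_stair`, `dWaveOrderParameter_le_stair` — for every compact
  `[μ₁,μ₂] ⊂ (-4,0)` there is `K > 0` with, for ALL real `U`, `μ ∈ [μ₁,μ₂]`, `h ∈ (0,1]`,
  `dWaveOrderParameter U μ ≤ liminf_L dWaveSourceDensity (L+1) U μ h ≤ K(1 + |log h|)h + |U|/h`;
* `dWaveOrderParameter_free_eq_zero` — the FREE gas has no `d`-wave order, `dWaveOrderParameter 0 μ = 0`
  on `(-4,0)` (so `0 < U` cannot be weakened to `0 ≤ U` in the crux: Lean reads `exp(-C/0²) = 1`);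
* `dWaveOrderParameter_le_sqrt` — `dWaveOrderParameter U μ ≤ K(1 + |log U|)√U` for `U ∈ (0,1]`;
  `dWaveOrderParameter_lt_of_small_coupling` — it tends to `0` as `U → 0⁺` uniformly on the compact;
* `cwChiralConstruction_false_uniformFloorOn` / `cwChiralConstruction_false_powerFloorOn` — the crux
  with `exp(-C/U²)` replaced by a constant floor `c₀ > 0`, resp. by `c·U^p` with `p < 1/2`, and `μ`
  confined to a compact of the hole-doped free band `(-4,0)` (density clause kept verbatim), is FALSE:
  the `U`-dependence of the floor is load-bearing; any admissible floor is `O(√U log(1/U))`.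

Proof of the ceiling: the stair bound of part 1 (`dWaveSourceDensity_le_freeGain`) and the tree's free
BdG Cooper logarithm `p̃₀(s) - p̃₀(0) ≤ C₀(1 + log β)s²` for `L ≥ max(3,⌈β⌉)`
(`dWaveSource_free_sourcedGain_le`), at `β = h⁻²`; then `h = √U`.

Sources: Koma–Tasaki, J. Stat. Phys. 76 (1994) 745, §1 (stair inequalities) [KomaTasaki1994];
Salmhofer, *Renormalization* (1999) §4.5.4 (Cooper logarithm) [Salmhofer1999]. Prose analysis:
work file `Cruxes/CwChiralConstruction/Disproof.lean`.
-/

noncomputable section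

namespace Summit.HubbardSuperconductivity.CwChiralConstruction.Negative

open Matrix Finset Filter Literature.MathematicalPhysics.QuantumLattice Literature.Probability.LatticeModels
open scoped Matrix.Norms.L2Operator ComplexOrder Topology

/-! ### The ceiling, stair by stair -/

/-- **The Cooper–Legendre ceiling, stair by stair.** For every compact `[μ₁,μ₂] ⊂ (-4,0)` there is
`K > 0` such that for ALL real `U`, `μ ∈ [μ₁,μ₂]` and `h ∈ (0,1]`:
`liminf_L dWaveSourceDensity (L+1) U μ h ≤ K(1 + |log h|)h + |U|/h`
(free Cooper logarithm at `β = h⁻²`, `L ≥ max(3,⌈β⌉)`, plus the `|U|` comparison). [cite: KomaTasaki1994, §1] -/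
theorem liminf_dWaveSourceDensity_le_stair :
    ∀ μ₁ μ₂ : ℝ, -4 < μ₁ → μ₁ ≤ μ₂ → μ₂ < 0 → ∃ K : ℝ, 0 < K ∧
      ∀ U μ h : ℝ, μ ∈ Set.Icc μ₁ μ₂ → 0 < h → h ≤ 1 →
        liminf (fun L : ℕ => dWaveSourceDensity (L + 1) U μ h) atTop ≤
          K * (1 + |Real.log h|) * h + |U| / h := by
  intro μ₁ μ₂ h4 h12 h0
  obtain ⟨C₀, hC₀, hfree⟩ := dWaveSource_free_sourcedGain_le μ₁ μ₂ h4 h12 h0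
  refine ⟨4 * C₀ + 1, by positivity, fun U μ h hμ hh hh1 => ?_⟩
  set β : ℝ := (h ^ 2)⁻¹ with hβdef
  have hβ1 : 1 ≤ β := by
    rw [hβdef, one_le_inv₀ (by positivity)]
    nlinarith
  have hβ : 0 < β := by positivity
  have hlogβ : Real.log β = 2 * |Real.log h| := by
    rw [hβdef, Real.log_inv, Real.log_pow, abs_of_nonpos (Real.log_nonpos hh.le hh1)]
    push_cast
    ring
  obtain ⟨L₀, hL₀⟩ := hfree β hβ1 μ hμ
  have hev : ∀ᶠ L : ℕ in atTop, dWaveSourceDensity (L + 1) U μ h ≤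
      (4 * C₀ + 1) * (1 + |Real.log h|) * h + |U| / h := by
    filter_upwards [eventually_ge_atTop L₀] with L hL
    have hLsq := cast_sq_pos_of_neZero (L + 1)
    -- free gain at `s = 2h`, rescaled from pressures to `log Z / β`
    have hg := hL₀ (L + 1) (by omega) (2 * h)
    rw [← sub_div, div_le_iff₀ (by positivity)] at hg
    have hg' : (Real.log (partitionFn β (dWaveSourceTorus (L + 1) 0 μ (2 * h))).re -
          Real.log (partitionFn β (dWaveSourceTorus (L + 1) 0 μ 0)).re) / β ≤
        C₀ * (1 + Real.log β) * (2 * h) ^ 2 * (((L + 1 : ℕ) : ℝ)) ^ 2 := by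
      rw [div_le_iff₀ hβ]
      nlinarith [hg]
    rw [hlogβ] at hg'
    have hd := dWaveSourceDensity_le_freeGain (L := L + 1) U μ hh hβ
    refine hd.trans ?_
    rw [div_le_iff₀ (by positivity)]
    have hβh : 2 * (((L + 1 : ℕ) : ℝ)) ^ 2 * Real.log 2 / β =
        2 * (((L + 1 : ℕ) : ℝ)) ^ 2 * Real.log 2 * h ^ 2 := by
      rw [hβdef, div_inv_eq_mul]
    rw [hβh]
    have hlog2 : Real.log 2 ≤ 1 := by
      have := Real.log_two_lt_d9; linarith
    have ha : 0 ≤ |Real.log h| := abs_nonneg _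
    have e : ((4 * C₀ + 1) * (1 + |Real.log h|) * h + |U| / h) * (2 * h * (((L + 1 : ℕ) : ℝ)) ^ 2) =
        ((8 * C₀ + 2) * (1 + |Real.log h|) * h ^ 2 + 2 * |U|) * (((L + 1 : ℕ) : ℝ)) ^ 2 := by
      field_simp
      ring
    rw [e]
    have hL2 : 0 ≤ (((L + 1 : ℕ) : ℝ)) ^ 2 := hLsq.le
    nlinarith [mul_nonneg (mul_nonneg hC₀.le ha) (mul_nonneg (sq_nonneg h) hL2),
      mul_nonneg (mul_nonneg ha (sq_nonneg h)) hL2, mul_nonneg (sq_nonneg h) hL2,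
      mul_nonneg (mul_nonneg hC₀.le (sq_nonneg h)) hL2]
  refine liminf_le_of_frequently_le hev.frequently ?_
  exact isBoundedUnder_of_eventually_ge (a := 0)
    (Eventually.of_forall fun L => dWaveSourceDensity_nonneg U μ hh.le)

/-- **The Cooper–Legendre ceiling on the order parameter.** For every compact `[μ₁,μ₂] ⊂ (-4,0)`
there is `K > 0` with `dWaveOrderParameter U μ ≤ K(1 + |log h|)h + |U|/h` for ALL real `U`,
`μ ∈ [μ₁,μ₂]`, `h ∈ (0,1]`. [cite: KomaTasaki1994, §1] -/
theorem dWaveOrderParameter_le_stair :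
    ∀ μ₁ μ₂ : ℝ, -4 < μ₁ → μ₁ ≤ μ₂ → μ₂ < 0 → ∃ K : ℝ, 0 < K ∧
      ∀ U μ h : ℝ, μ ∈ Set.Icc μ₁ μ₂ → 0 < h → h ≤ 1 →
        dWaveOrderParameter U μ ≤ K * (1 + |Real.log h|) * h + |U| / h := by
  intro μ₁ μ₂ h4 h12 h0
  obtain ⟨K, hK, H⟩ := liminf_dWaveSourceDensity_le_stair μ₁ μ₂ h4 h12 h0
  exact ⟨K, hK, fun U μ h hμ hh hh1 =>
    (dWaveOrderParameter_le_liminf U μ hh).trans (H U μ h hμ hh hh1)⟩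

/-- `(1 + |log h|)·h^q → 0` as `h → 0⁺` for `q > 0`. [folklore] -/
theorem tendsto_one_add_abs_log_mul_rpow {q : ℝ} (hq : 0 < q) :
    Tendsto (fun U : ℝ => (1 + |Real.log U|) * U ^ q) (𝓝[>] 0) (𝓝 0) := by
  have h1 : Tendsto (fun U : ℝ => Real.log U * U ^ q) (𝓝[>] 0) (𝓝 0) :=
    tendsto_log_mul_rpow_nhdsGT_zero hq
  have h2 : Tendsto (fun U : ℝ => U ^ q) (𝓝[>] 0) (𝓝 0) := by
    have h := (Real.continuous_rpow_const hq.le).tendsto 0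
    rw [Real.zero_rpow hq.ne'] at h
    exact tendsto_nhdsWithin_of_tendsto_nhds h
  have h3 : Tendsto (fun U : ℝ => |Real.log U * U ^ q|) (𝓝[>] 0) (𝓝 0) := by
    simpa using h1.abs
  have h4 : Tendsto (fun U : ℝ => U ^ q + |Real.log U * U ^ q|) (𝓝[>] 0) (𝓝 0) := by
    simpa using h2.add h3
  refine h4.congr' ?_
  filter_upwards [self_mem_nhdsWithin] with x hx
  rw [abs_mul, abs_of_nonneg (Real.rpow_nonneg (le_of_lt hx) q)]
  ring

/-- `(1 + |log h|)·h → 0` as `h → 0⁺`. [folklore] -/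
theorem tendsto_one_add_abs_log_mul : Tendsto (fun h : ℝ => (1 + |Real.log h|) * h) (𝓝[>] 0) (𝓝 0) := by
  refine (tendsto_one_add_abs_log_mul_rpow zero_lt_one).congr' ?_
  filter_upwards [self_mem_nhdsWithin] with x hx
  rw [Real.rpow_one]

/-- `(1 + |log U|)·√U → 0` as `U → 0⁺`. [folklore] -/
theorem tendsto_one_add_abs_log_mul_sqrt :
    Tendsto (fun U : ℝ => (1 + |Real.log U|) * Real.sqrt U) (𝓝[>] 0) (𝓝 0) := by
  refine (tendsto_one_add_abs_log_mul_rpow (q := 1 / 2) (by norm_num)).congr' ?_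
  filter_upwards [self_mem_nhdsWithin] with x hx
  rw [Real.sqrt_eq_rpow]

/-- **The free gas has no `d`-wave order**: `dWaveOrderParameter 0 μ = 0` for every `μ ∈ (-4,0)`
(hole-doped free band). In particular the crux's hypothesis `0 < U` cannot be weakened to `0 ≤ U`:
at `U = 0` Lean reads the floor `exp(-C/U²)` as `exp 0 = 1 > 0 = dWaveOrderParameter 0 μ`. [cite: KomaTasaki1994, §1] -/
theorem dWaveOrderParameter_free_eq_zero {μ : ℝ} (h4 : -4 < μ) (h0 : μ < 0) :
    dWaveOrderParameter 0 μ = 0 := by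
  obtain ⟨K, hK, H⟩ := dWaveOrderParameter_le_stair μ μ h4 le_rfl h0
  refine le_antisymm ?_ (dWaveOrderParameter_nonneg 0 μ)
  have hlim : Tendsto (fun h : ℝ => K * ((1 + |Real.log h|) * h)) (𝓝[>] 0) (𝓝 0) := by
    simpa using tendsto_one_add_abs_log_mul.const_mul K
  refine ge_of_tendsto hlim ?_
  filter_upwards [Ioc_mem_nhdsGT zero_lt_one] with h hh
  have := H 0 μ h ⟨le_rfl, le_rfl⟩ hh.1 hh.2
  simpa [mul_assoc] using this

/-- **Square-root ceiling**: `dWaveOrderParameter U μ ≤ K(1 + |log U|)√U` for `U ∈ (0,1]`,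
`μ ∈ [μ₁,μ₂]` (the stair `h = √U`). [cite: KomaTasaki1994, §1] -/
theorem dWaveOrderParameter_le_sqrt :
    ∀ μ₁ μ₂ : ℝ, -4 < μ₁ → μ₁ ≤ μ₂ → μ₂ < 0 → ∃ K : ℝ, 0 < K ∧
      ∀ U μ : ℝ, 0 < U → U ≤ 1 → μ ∈ Set.Icc μ₁ μ₂ →
        dWaveOrderParameter U μ ≤ K * (1 + |Real.log U|) * Real.sqrt U := by
  intro μ₁ μ₂ h4 h12 h0
  obtain ⟨K, hK, H⟩ := dWaveOrderParameter_le_stair μ₁ μ₂ h4 h12 h0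
  refine ⟨K + 1, by positivity, fun U μ hU hU1 hμ => ?_⟩
  have hs : 0 < Real.sqrt U := Real.sqrt_pos.2 hU
  have hs1 : Real.sqrt U ≤ 1 := Real.sqrt_le_one.mpr hU1
  have := H U μ (Real.sqrt U) hμ hs hs1
  have hlog : |Real.log (Real.sqrt U)| ≤ |Real.log U| := by
    rw [Real.log_sqrt hU.le, abs_div, abs_two]
    have := abs_nonneg (Real.log U)
    linarith
  have hUs : |U| / Real.sqrt U = Real.sqrt U := by
    rw [abs_of_pos hU, div_eq_iff hs.ne', Real.mul_self_sqrt hU.le]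
  rw [hUs] at this
  refine this.trans ?_
  have ha : 0 ≤ |Real.log U| := abs_nonneg _
  nlinarith [mul_le_mul_of_nonneg_right hlog (mul_nonneg hK.le hs.le), mul_nonneg ha hs.le]

/-- **The order parameter vanishes as `U → 0⁺`, uniformly on `μ`-compacts of `(-4,0)`**: for every
`ε > 0` there is `U₁ > 0` with `dWaveOrderParameter U μ < ε` for all `U ∈ (0,U₁)`, `μ ∈ [μ₁,μ₂]`.
[cite: KomaTasaki1994, §1] -/
theorem dWaveOrderParameter_lt_of_small_coupling :
    ∀ μ₁ μ₂ : ℝ, -4 < μ₁ → μ₁ ≤ μ₂ → μ₂ < 0 → ∀ ε : ℝ, 0 < ε → ∃ U₁ : ℝ, 0 < U₁ ∧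
      ∀ U μ : ℝ, 0 < U → U < U₁ → μ ∈ Set.Icc μ₁ μ₂ → dWaveOrderParameter U μ < ε := by
  intro μ₁ μ₂ h4 h12 h0 ε hε
  obtain ⟨K, hK, H⟩ := dWaveOrderParameter_le_sqrt μ₁ μ₂ h4 h12 h0
  have hlim : Tendsto (fun U : ℝ => K * ((1 + |Real.log U|) * Real.sqrt U)) (𝓝[>] 0) (𝓝 0) := by
    simpa using tendsto_one_add_abs_log_mul_sqrt.const_mul K
  have hev : ∀ᶠ U in 𝓝[>] (0 : ℝ), K * ((1 + |Real.log U|) * Real.sqrt U) < ε :=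
    hlim (Iio_mem_nhds (by simpa using hε))
  rw [Filter.Eventually, mem_nhdsGT_iff_exists_Ioo_subset] at hev
  obtain ⟨u, hu, hsub⟩ := hev
  refine ⟨min u 1, lt_min hu one_pos, fun U μ hU hUu hμ => ?_⟩
  have hU1 : U ≤ 1 := hUu.le.trans (min_le_right _ _)
  have hUu' : U < u := lt_of_lt_of_le hUu (min_le_left _ _)
  have h1 := H U μ hU hU1 hμ
  have h2 : K * ((1 + |Real.log U|) * Real.sqrt U) < ε := hsub ⟨hU, hUu'⟩
  rw [← mul_assoc] at h2
  exact lt_of_le_of_lt h1 h2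

/-! ### Refuted strengthenings: the `U`-dependence of the floor is load-bearing -/

/-- **No `U`-uniform floor.** For every compact `[μ₁,μ₂] ⊂ (-4,0)`: the crux `CwChiralConstruction`
with its floor `exp(-C/U²)` replaced by a CONSTANT `c₀ > 0` and `μ` confined to `[μ₁,μ₂]` (density
clause kept verbatim) is FALSE — the order parameter is `O(√U log(1/U))` there. [cite: KomaTasaki1994, §1] -/
theorem cwChiralConstruction_false_uniformFloorOn {μ₁ μ₂ : ℝ} (h4 : -4 < μ₁) (h12 : μ₁ ≤ μ₂)
    (h0 : μ₂ < 0) :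
    ¬ (∃ U₀ : ℝ, 0 < U₀ ∧ ∃ c₀ : ℝ, 0 < c₀ ∧ ∀ U ∈ Set.Ioo (0:ℝ) U₀,
        ∃ δ ∈ Set.Icc (3/10 : ℝ) (12/25), ∃ μ ∈ Set.Icc μ₁ μ₂,
          Tendsto (fun L : ℕ => ((hubbardTorusWith 2 (L + 1) 1 U μ).groundStateFunctional
            totalNumber).re / ((L + 1 : ℕ) : ℝ) ^ 2) atTop (𝓝 (1 - δ)) ∧
          c₀ ≤ dWaveOrderParameter U μ) := by
  rintro ⟨U₀, hU₀, c₀, hc₀, H⟩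
  obtain ⟨U₁, hU₁, hsmall⟩ := dWaveOrderParameter_lt_of_small_coupling μ₁ μ₂ h4 h12 h0 c₀ hc₀
  set U := min U₀ U₁ / 2 with hUdef
  have hU : 0 < U := by rw [hUdef]; exact div_pos (lt_min hU₀ hU₁) two_pos
  have hUU₀ : U < U₀ := by
    have := min_le_left U₀ U₁; rw [hUdef]; linarith
  have hUU₁ : U < U₁ := by
    have := min_le_right U₀ U₁; rw [hUdef]; linarith
  obtain ⟨δ, _, μ, hμ, _, hfloor⟩ := H U ⟨hU, hUU₀⟩
  exact (hsmall U μ hU hUU₁ hμ).not_ge hfloor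

/-- **No power-law floor with exponent `< 1/2`.** For `[μ₁,μ₂] ⊂ (-4,0)` and `p < 1/2`, the crux with
floor `c·U^p` in place of `exp(-C/U²)` (μ confined to `[μ₁,μ₂]`, density clause verbatim) is FALSE.
[cite: KomaTasaki1994, §1] -/
theorem cwChiralConstruction_false_powerFloorOn {μ₁ μ₂ p : ℝ} (h4 : -4 < μ₁) (h12 : μ₁ ≤ μ₂)
    (h0 : μ₂ < 0) (hp : p < 1 / 2) :
    ¬ (∃ U₀ : ℝ, 0 < U₀ ∧ ∃ c : ℝ, 0 < c ∧ ∀ U ∈ Set.Ioo (0:ℝ) U₀,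
        ∃ δ ∈ Set.Icc (3/10 : ℝ) (12/25), ∃ μ ∈ Set.Icc μ₁ μ₂,
          Tendsto (fun L : ℕ => ((hubbardTorusWith 2 (L + 1) 1 U μ).groundStateFunctional
            totalNumber).re / ((L + 1 : ℕ) : ℝ) ^ 2) atTop (𝓝 (1 - δ)) ∧
          c * U ^ p ≤ dWaveOrderParameter U μ) := by
  rintro ⟨U₀, hU₀, c, hc, H⟩
  obtain ⟨K, hK, hK'⟩ := dWaveOrderParameter_le_sqrt μ₁ μ₂ h4 h12 h0
  have hq : 0 < 1 / 2 - p := by linarith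
  have hlim : Tendsto (fun U : ℝ => K * ((1 + |Real.log U|) * U ^ (1 / 2 - p))) (𝓝[>] 0) (𝓝 0) := by
    simpa using (tendsto_one_add_abs_log_mul_rpow hq).const_mul K
  have hev : ∀ᶠ U in 𝓝[>] (0 : ℝ), K * ((1 + |Real.log U|) * U ^ (1 / 2 - p)) < c :=
    hlim (Iio_mem_nhds hc)
  rw [Filter.Eventually, mem_nhdsGT_iff_exists_Ioo_subset] at hev
  obtain ⟨u, hu, hsub⟩ := hev
  set U := min (min U₀ u) 1 / 2 with hUdef
  have hU : 0 < U := by rw [hUdef]; exact div_pos (lt_min (lt_min hU₀ hu) one_pos) two_pos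
  have hUU₀ : U < U₀ := by
    have := (min_le_left (min U₀ u) 1).trans (min_le_left U₀ u); rw [hUdef]; linarith
  have hUu : U < u := by
    have := (min_le_left (min U₀ u) 1).trans (min_le_right U₀ u); rw [hUdef]; linarith
  have hU1 : U ≤ 1 := by
    have := min_le_right (min U₀ u) 1; rw [hUdef]; linarith
  obtain ⟨δ, _, μ, hμ, _, hfloor⟩ := H U ⟨hU, hUU₀⟩
  have h1 := hK' U μ hU hU1 hμ
  have h2 : K * ((1 + |Real.log U|) * U ^ (1 / 2 - p)) < c := hsub ⟨hU, hUu⟩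
  have hUp : 0 < U ^ p := Real.rpow_pos_of_pos hU p
  have h3 : K * ((1 + |Real.log U|) * U ^ (1 / 2 - p)) * U ^ p < c * U ^ p :=
    mul_lt_mul_of_pos_right h2 hUp
  have h4' : U ^ (1 / 2 - p) * U ^ p = Real.sqrt U := by
    rw [← Real.rpow_add hU, Real.sqrt_eq_rpow]
    norm_num
  have h5 : K * ((1 + |Real.log U|) * U ^ (1 / 2 - p)) * U ^ p =
      K * (1 + |Real.log U|) * Real.sqrt U := by
    rw [← h4']; ring
  rw [h5] at h3
  exact (lt_of_le_of_lt h1 h3).not_ge hfloor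

end Summit.HubbardSuperconductivity.CwChiralConstruction.Negative

end
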